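import Mathlib
import Summits.Ventures.PercRepro2.Defs
import Summits.Ventures.PercRepro2.Graph
import Summits.Ventures.PercRepro2.HullDefs
import Summits.Ventures.PercRepro2.LocRows
import Summits.Ventures.PercRepro2.SwRow
import Summits.Ventures.PercRepro2.SwAllRow
import Summits.Ventures.PercRepro2.HullOrdDefs

/-!
# Row (PA-l), part 2: the class proportion and `HullOrdDom → Sw` (blind cell PercRepro2,
night-4 g8, 2026-08-25; proofs/NIGHT4-G8.md §1–§2)

With the hull datum, its class `hullClass`, the blue-favourable order `HullLe` and the coupling
inequality `card_mul_le_of_hullLe` of `HullOrdDefs`: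

* `prop` — the proportion of the class of `ζ` lying in `{C_B(h) ∈ 𝓥}`; `prop_mono`: it is increasing
  in `HullLe` (the coupling inequality); `sum_prop_eq_card`: on a union of classes its sum is the
  count of `{C_B(h) ∈ 𝓥}` (double counting over the classes);
* **`sw_of_hullOrdDom`**: row (PA-l) gives row (SW) — the proportions of the source side are moved
  along the injection to the target side, and the counting form `sw_of_card_le` of (SW) follows;
  `sw_all_of_hullOrdDom_all : HullOrdDom_all → Sw_all` (hence the free-fibre row 2′DOM and (BASE)).
-/

namespace Summit.Ventures.PercRepro2

namespace LocRows

open Hull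

variable {V : Type*} {E : Type*} [Fintype E] [DecidableEq E]

open scoped Classical

variable {ends : E → Sym2 V}

/-! ## The class proportion and its monotonicity -/

variable (ends) in
/-- The proportion of the class of `ζ` lying in `{C_B(h) ∈ 𝓥}`. -/
noncomputable def prop (l h : V) (𝓥 : Set (Set V)) (ζ : Config E) : ℚ :=
  (((hullClass ends l ζ).filter fun ζ' => cluster ends (blue ζ') h ∈ 𝓥).card : ℚ) /
    ((hullClass ends l ζ).card : ℚ)

/-- Classes are nonempty. -/
lemma hullClass_card_pos (l : V) (ζ : Config E) : 0 < (hullClass ends l ζ).card :=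
  Finset.card_pos.2 ⟨ζ, self_mem_hullClass l ζ⟩

/-- The proportion is nonnegative. -/
lemma prop_nonneg (l h : V) (𝓥 : Set (Set V)) (ζ : Config E) : 0 ≤ prop ends l h 𝓥 ζ := by
  unfold prop; positivity

/-- The proportion is constant on a class. -/
lemma prop_eq_of_mem {l : V} (h : V) (𝓥 : Set (Set V)) {ζ ζ' : Config E}
    (hm : ζ' ∈ hullClass ends l ζ) : prop ends l h 𝓥 ζ' = prop ends l h 𝓥 ζ := by
  simp only [prop, hullClass_eq_of_mem hm]

/-- The proportion is increasing in the blue-favourable order. -/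
lemma prop_mono {l h : V} {𝓥 : Set (Set V)} (h𝓥 : IsUpperSet 𝓥) {ζ ζ' : Config E}
    (hh : h ∉ hull ends ζ l) (hle : HullLe ends l ζ ζ') :
    prop ends l h 𝓥 ζ ≤ prop ends l h 𝓥 ζ' := by
  unfold prop
  rw [div_le_div_iff₀ (by exact_mod_cast hullClass_card_pos l ζ)
    (by exact_mod_cast hullClass_card_pos l ζ')]
  exact_mod_cast card_mul_le_of_hullLe h𝓥 hh hle

/-! ## Summing the proportions over a union of classes -/

/-- On a union of classes `S` the sum of the proportions is the number of configurations of `S` with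
`C_B(h) ∈ 𝓥`. -/
lemma sum_prop_eq_card {l : V} (h : V) (𝓥 : Set (Set V)) {S : Finset (Config E)}
    (hS : ∀ ζ ∈ S, ∀ ζ' ∈ hullClass ends l ζ, ζ' ∈ S) :
    ∑ ζ ∈ S, prop ends l h 𝓥 ζ =
      ((S.filter fun ζ => cluster ends (blue ζ) h ∈ 𝓥).card : ℚ) := by
  -- each proportion as a sum over `S`
  have hA : ∀ ζ ∈ S, prop ends l h 𝓥 ζ =
      ∑ ζ' ∈ S, (if ζ' ∈ hullClass ends l ζ ∧ cluster ends (blue ζ') h ∈ 𝓥 then (1 : ℚ) else 0) /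
        ((hullClass ends l ζ).card : ℚ) := by
    intro ζ hζ
    unfold prop
    rw [← Finset.sum_div]
    congr 1
    have hfil : ((hullClass ends l ζ).filter fun ζ' => cluster ends (blue ζ') h ∈ 𝓥) =
        S.filter fun ζ' => ζ' ∈ hullClass ends l ζ ∧ cluster ends (blue ζ') h ∈ 𝓥 := by
      ext ζ'
      simp only [Finset.mem_filter]
      constructor
      · rintro ⟨h1, h2⟩; exact ⟨hS ζ hζ ζ' h1, h1, h2⟩
      · rintro ⟨_, h1, h2⟩; exact ⟨h1, h2⟩
    rw [hfil, Finset.card_filter]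
    push_cast
    rfl
  rw [Finset.sum_congr rfl hA, Finset.sum_comm, Finset.card_filter]
  push_cast
  refine Finset.sum_congr rfl fun ζ' hζ' => ?_
  by_cases hP : cluster ends (blue ζ') h ∈ 𝓥
  · simp only [hP, and_true, if_true]
    have hterm : ∀ ζ ∈ S, (if ζ' ∈ hullClass ends l ζ then (1 : ℚ) else 0) /
        ((hullClass ends l ζ).card : ℚ) =
        if ζ ∈ hullClass ends l ζ' then 1 / ((hullClass ends l ζ').card : ℚ) else 0 := by
      intro ζ _
      by_cases hm : ζ' ∈ hullClass ends l ζ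
      · have hm' := mem_hullClass_symm hm
        rw [if_pos hm, if_pos hm', hullClass_eq_of_mem hm]
      · have hm' : ζ ∉ hullClass ends l ζ' := fun h' => hm (mem_hullClass_symm h')
        simp only [hm, hm', if_false, zero_div]
    rw [Finset.sum_congr rfl hterm, ← Finset.sum_filter]
    have hfil : S.filter (fun ζ => ζ ∈ hullClass ends l ζ') = hullClass ends l ζ' := by
      ext ζ
      simp only [Finset.mem_filter]
      constructor
      · rintro ⟨_, h2⟩; exact h2
      · intro h2; exact ⟨hS ζ' hζ' ζ h2, h2⟩
    rw [hfil, Finset.sum_const, nsmul_eq_mul]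
    have hpos : ((hullClass ends l ζ').card : ℚ) ≠ 0 := by
      exact_mod_cast (hullClass_card_pos l ζ').ne'
    field_simp
  · simp only [hP, and_false, if_false, zero_div, Finset.sum_const_zero]

/-! ## (PA-l) gives (SW) -/

/-- A source configuration has `h` outside the hull of `l`. -/
lemma not_mem_hull_of_mem_srcU {l h o : V} {ζ : Config E}
    (hζ : ζ ∈ srcU ends l h {S : Set V | o ∈ S}) : h ∉ hull ends ζ l := by
  simp only [srcU, Finset.mem_filter, Finset.mem_univ, true_and] at hζ
  exact hζ.1

/-- **Row (PA-l) gives row (SW)**: the class proportion of `{C_B(h) ∈ 𝓥}` is increasing along the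
injection (`prop_mono`), and its sum over a side is the side's count (`sum_prop_eq_card`). -/
theorem sw_of_hullOrdDom {l h o : V} (hd : HullOrdDom ends l h o) : Sw ends l h o := by
  obtain ⟨f, hf, hmem⟩ := hd
  refine sw_of_card_le ends l h o fun 𝓥 h𝓥 => ?_
  have hsrc := sum_prop_eq_card (ends := ends) (l := l) h 𝓥
    (S := srcU ends l h {S : Set V | o ∈ S}) (fun ζ hζ ζ' hζ' => mem_srcU_of_mem hζ' hζ)
  have htgt := sum_prop_eq_card (ends := ends) (l := l) h 𝓥
    (S := tgtU ends l h {S : Set V | o ∈ S}) (fun ζ hζ ζ' hζ' => mem_tgtU_of_mem hζ' hζ)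
  have key : ∑ ζ ∈ srcU ends l h {S : Set V | o ∈ S}, prop ends l h 𝓥 ζ ≤
      ∑ ζ ∈ tgtU ends l h {S : Set V | o ∈ S}, prop ends l h 𝓥 ζ := by
    calc ∑ ζ ∈ srcU ends l h {S : Set V | o ∈ S}, prop ends l h 𝓥 ζ
        = ∑ x ∈ (srcU ends l h {S : Set V | o ∈ S}).attach, prop ends l h 𝓥 x.1 :=
          (Finset.sum_attach _ _).symm
      _ ≤ ∑ x ∈ (srcU ends l h {S : Set V | o ∈ S}).attach, prop ends l h 𝓥 (f x) :=
          Finset.sum_le_sum fun x _ =>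
            prop_mono h𝓥 (not_mem_hull_of_mem_srcU x.2) (hmem x).2
      _ = ∑ y ∈ (srcU ends l h {S : Set V | o ∈ S}).attach.image f, prop ends l h 𝓥 y :=
          (Finset.sum_image fun x _ y _ hxy => hf hxy).symm
      _ ≤ ∑ y ∈ tgtU ends l h {S : Set V | o ∈ S}, prop ends l h 𝓥 y := by
          refine Finset.sum_le_sum_of_subset_of_nonneg ?_ fun y _ _ => prop_nonneg l h 𝓥 y
          intro y hy
          rw [Finset.mem_image] at hy
          obtain ⟨x, _, rfl⟩ := hy
          exact (hmem x).1
  rw [hsrc, htgt] at key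
  exact_mod_cast key

/-- Row (PA-l) over all finite graphs and markings. -/
def HullOrdDom_all : Prop :=
  ∀ (V E : Type) [Fintype V] [DecidableEq V] [Fintype E] [DecidableEq E] (ends : E → Sym2 V)
    (l h o : V), l ≠ h → o ≠ l → o ≠ h → HullOrdDom ends l h o

/-- `HullOrdDom_all` gives `Sw_all` (hence the free-fibre row 2′DOM and (BASE) everywhere). -/
theorem sw_all_of_hullOrdDom_all (hd : HullOrdDom_all) : Sw_all := by
  intro V E _ _ _ _ ends l h o hlh hol hoh
  exact sw_of_hullOrdDom (hd V E ends l h o hlh hol hoh)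

end LocRows

end Summit.Ventures.PercRepro2
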